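import Summits.RiemannHypothesis.RiemannHypothesis.Theorems.SignConeConeMagnificationTorusFinite

/-!
# `SignCone.ConeMagnification`, line `Sketch` (r3): the torus inequality for `ℓ¹`-modifications of `Λ`
(crux stmt-RiemannHypothesis-16303; HELPER file, `--supports`; registered sub-goal `torusOfCara_of_summable`)

`SignConeConeMagnificationTorusFinite{Boundary,Mean,}.lean` prove the open core `stub_torusOfCara` for EVENTUALLY-`Λ`
weights.  Here the hypothesis is weakened to `Σ |c(n) − Λ(n)|/√n < ∞` (`torusOfCara_of_summable`): truncate `c − Λ` at
`n < M`; the truncated weight is eventually `Λ`, its continuation `F_M = F − Σ_{n≥M}(c−Λ)(n) n^{-s}` is holomorphic on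
`re s > 1/2` (absolute convergence) and satisfies the Carathéodory majorant up to the tail
`ε_M = Σ_{n≥M} |c−Λ|(n)/√n`; so part I is re-run with `1/2` replaced by an arbitrary constant `κ`
(`dirichletPoly_re_le_const_add_re_logDeriv_riemannXi`, `re_dirichletPoly_critical_le_const` — verbatim the proofs of
`…TorusFiniteBoundary.lean`), the scaling `a ↦ a/(2κ_M)` feeds `torusSum_le_half_of_re_le_half`, the torus sum of
`c_M − Λ` is `≤ 1/2 + ε_M`, equals that of `c − Λ` once `M > n_S`, and `ε_M → 0`.

This is the natural boundary of the "soft" argument: for `ℓ¹`-modifications `L_{c−Λ}` is continuous up to the critical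
line and the zeta atoms of the spectral measure never enter.  Beyond `ℓ¹` lies the open core (calibrated in
`SignConeConeMagnificationCalibration.lean`: it contains an `Ω₊`-theorem for `Re ζ`).
-/

noncomputable section

-- `Summit.RiemannHypothesis.RiemannHypothesis.…` repeats a namespace component by design (D-0017 layout).
set_option linter.dupNamespace false

open scoped BigOperators ComplexConjugate Topology
open Complex Filter Set

namespace Summit.RiemannHypothesis.RiemannHypothesis.Theorems.SignConeConeMagnification

open Literature.NumberTheory.LFunctions ArithmeticFunction

/-- **From a Carathéodory-type majorant with constant `κ` to `Re P ≤ κ + Re ξ'/ξ`** (the landed `κ = 1/2` case is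
`dirichletPoly_re_le_half_add_re_logDeriv_riemannXi`; identical proof).  Let `c = Λ`
off `{n < N}`, `L_c` absolutely convergent on `re s > 1`, and `F` holomorphic on `re s > 1/2` with
`F = L_c − 1/(s−1)` on `re s > 1` and `Re F ≤ 1/2 + Re(1/s) + ½Re ψ(s/2) − ½log π` on `re s > 1/2`.  Then at every
`s` with `re s > 1/2`, `ζ₁(s) ≠ 0`: `Re P(s) ≤ 1/2 + Re ξ'/ξ(s)` for the Dirichlet polynomial `P` of `c − Λ`.
Proof: `Ψ := (F − P)·ζ₁ + ζ₁'` is holomorphic on the half-plane and `0` on `re s > 1`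
(`L_c = L_Λ + P`, `ζ₁'/ζ₁ = 1/(s−1) − L_Λ`), hence `0` (identity theorem on a convex set); so
`P = F + ζ₁'/ζ₁` where `ζ₁ ≠ 0`, and `1/s + Γ_ℝ'/Γ_ℝ + ζ₁'/ζ₁ = ξ'/ξ`, `Γ_ℝ'/Γ_ℝ = −½log π + ½ψ(s/2)`. [folklore] -/
theorem dirichletPoly_re_le_const_add_re_logDeriv_riemannXi (κ : ℝ) {c : ℕ → ℝ} {N : ℕ}
    (hN : ∀ n, N ≤ n → c n = Λ n)
    (hsum : ∀ σ : ℝ, 1 < σ → LSeriesSummable (fun n => ((c n : ℝ) : ℂ)) σ)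
    {F : ℂ → ℂ} (hF : DifferentiableOn ℂ F {s : ℂ | 1 / 2 < s.re})
    (hFeq : ∀ s : ℂ, 1 < s.re → F s = LSeries (fun n => ((c n : ℝ) : ℂ)) s - 1 / (s - 1))
    (hcara : ∀ s : ℂ, 1 / 2 < s.re →
      (F s).re ≤ κ + (1 / s).re + (Complex.digamma (s / 2)).re / 2 - Real.log Real.pi / 2)
    {s : ℂ} (hs : 1 / 2 < s.re) (hζ : riemannZeta₁ s ≠ 0) :
    (∑ n ∈ Finset.Ico 1 N, ((c n - Λ n : ℝ) : ℂ) / (n : ℂ) ^ s).re ≤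
      κ + (logDeriv riemannXi s).re := by
  set P : ℂ → ℂ := fun z => ∑ n ∈ Finset.Ico 1 N, ((c n - Λ n : ℝ) : ℂ) / (n : ℂ) ^ z with hP
  have hPd : Differentiable ℂ P := differentiable_dirichletPoly _ N
  -- `L_c` converges absolutely at every `z` with `re z > 1` (compare with the real point `re z`)
  have hsumz : ∀ z : ℂ, 1 < z.re → LSeriesSummable (fun n => ((c n : ℝ) : ℂ)) z := fun z hz =>
    (LSeriesSummable_iff_of_re_eq_re (show (z.re : ℂ).re = z.re by simp)).mp (hsum z.re hz)
  -- on `re z > 1`: `F = P − ζ₁'/ζ₁`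
  have hright : ∀ z : ℂ, 1 < z.re → F z = P z - logDeriv riemannZeta₁ z := by
    intro z hz
    have hc : (fun n => ((c n : ℝ) : ℂ)) = (fun n => ((Λ n : ℝ) : ℂ)) + fun n => ((c n - Λ n : ℝ) : ℂ) := by
      ext n
      simp only [Pi.add_apply]
      push_cast
      ring
    have hL : LSeries (fun n => ((c n : ℝ) : ℂ)) z =
        LSeries (fun n => ((Λ n : ℝ) : ℂ)) z + P z := by
      rw [hc, LSeries_add (ArithmeticFunction.LSeriesSummable_vonMangoldt hz)
        (lseriesSummable_sub_vonMangoldt hN z), lseries_sub_vonMangoldt_eq_sum hN z]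
    rw [hFeq z hz, hL]
    have hζ₁ := logDeriv_riemannZeta₁_eq_of_one_lt_re hz
    -- `hζ₁ : logDeriv ζ₁ z = 1/(z-1) - L ↗Λ z`
    rw [hζ₁]
    ring
  -- the holomorphic combination `Ψ = (F − P)·ζ₁ + ζ₁'` vanishes identically on the half-plane
  set Ψ : ℂ → ℂ := fun z => (F z - P z) * riemannZeta₁ z + deriv riemannZeta₁ z with hΨ
  have hopen : IsOpen {z : ℂ | 1 / 2 < z.re} := isOpen_lt continuous_const Complex.continuous_re
  have hΨa : AnalyticOnNhd ℂ Ψ {z : ℂ | 1 / 2 < z.re} := by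
    have hFa : AnalyticOnNhd ℂ F {z : ℂ | 1 / 2 < z.re} :=
      (Complex.analyticOnNhd_iff_differentiableOn hopen).mpr hF
    have hPa : AnalyticOnNhd ℂ P {z : ℂ | 1 / 2 < z.re} :=
      (Complex.analyticOnNhd_univ_iff_differentiable.mpr hPd).mono (subset_univ _)
    have hζa : AnalyticOnNhd ℂ riemannZeta₁ {z : ℂ | 1 / 2 < z.re} :=
      (Complex.analyticOnNhd_univ_iff_differentiable.mpr differentiable_riemannZeta₁).mono (subset_univ _)
    have hdζa : AnalyticOnNhd ℂ (deriv riemannZeta₁) {z : ℂ | 1 / 2 < z.re} :=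
      (Complex.analyticOnNhd_univ_iff_differentiable.mpr differentiable_riemannZeta₁.deriv).mono
        (subset_univ _)
    exact ((hFa.sub hPa).mul hζa).add hdζa
  have hΨ2 : Ψ =ᶠ[𝓝 (2 : ℂ)] 0 := by
    have hmem : {z : ℂ | 1 < z.re} ∈ 𝓝 (2 : ℂ) :=
      (isOpen_lt continuous_const Complex.continuous_re).mem_nhds (by simp)
    filter_upwards [hmem] with z hz
    have hz' : 1 < z.re := hz
    have hζz : riemannZeta₁ z ≠ 0 := (riemannZeta₁_ne_zero_of_riemannXi hz'.le).2
    simp only [hΨ, Pi.zero_apply, hright z hz', logDeriv_apply]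
    field_simp
    ring
  have hΨ0 : EqOn Ψ 0 {z : ℂ | 1 / 2 < z.re} :=
    hΨa.eqOn_zero_of_preconnected_of_eventuallyEq_zero (convex_halfSpace_re_gt (1 / 2)).isPreconnected
      (z₀ := 2) (by simp; norm_num) hΨ2
  -- at `s`: `P s = F s + ζ₁'/ζ₁(s)`
  have hPs : P s = F s + logDeriv riemannZeta₁ s := by
    have h0 : (F s - P s) * riemannZeta₁ s + deriv riemannZeta₁ s = 0 := hΨ0 hs
    rw [logDeriv_apply]
    field_simp
    linear_combination -h0
  -- the majorant, rewritten through `ξ'/ξ = 1/s + Γ_ℝ'/Γ_ℝ + ζ₁'/ζ₁`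
  have hs0 : 0 < s.re := by linarith
  have hxi : logDeriv riemannXi s = 1 / s + logDeriv Gammaℝ s + logDeriv riemannZeta₁ s :=
    logDeriv_riemannXi_eq hs0 hζ
  have hG : logDeriv Gammaℝ s = -(Complex.log Real.pi) / 2 + Complex.digamma (s / 2) / 2 :=
    Literature.NumberTheory.LFunctions.logDeriv_Gammaℝ (half_ne_neg_nat_of_re_pos' hs0)
  have hre : (logDeriv riemannXi s).re =
      (1 / s).re - Real.log Real.pi / 2 + (Complex.digamma (s / 2)).re / 2 + (logDeriv riemannZeta₁ s).re := by
    rw [hxi, hG, ← Complex.ofReal_log Real.pi_pos.le]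
    simp only [add_re, neg_re, div_ofNat_re, Complex.ofReal_re, neg_div]
    ring
  have hmaj := hcara s hs
  have hPre : (P s).re = (F s).re + (logDeriv riemannZeta₁ s).re := by rw [hPs, add_re]
  show (P s).re ≤ κ + (logDeriv riemannXi s).re
  rw [hPre, hre]
  linarith

/-- **`Re P(1/2 + it) ≤ κ` for every real `t`** (the boundary form of the `κ`-majorant for an eventually-`Λ` weight; the
landed `κ = 1/2` case is `re_dirichletPoly_critical_le_half`).  At a `t` with `ξ(1/2+it) ≠ 0` (so `ζ₁ ≠ 0` nearby) let `σ ↓ 1/2` in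
`dirichletPoly_re_le_half_add_re_logDeriv_riemannXi` (`ξ'/ξ` is continuous there and `Re ξ'/ξ(1/2+it) = 0`);
the zeros of `ξ` are isolated (`ξ ≢ 0`: `ξ(0) = 1/2`), so every other `t` is a limit of such, and `P` is
continuous.  This is the registered sub-goal of the eventually-`Λ` case of `stub_torusOfCara`. [folklore] -/
theorem re_dirichletPoly_critical_le_const :
    ∀ κ : ℝ, ∀ c : ℕ → ℝ, ∀ N : ℕ, (∀ n, N ≤ n → c n = ArithmeticFunction.vonMangoldt n) →
      (∀ σ : ℝ, 1 < σ → LSeriesSummable (fun n => ((c n : ℝ) : ℂ)) σ) →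
      (∃ F : ℂ → ℂ, DifferentiableOn ℂ F {s : ℂ | 1 / 2 < s.re} ∧
        (∀ s : ℂ, 1 < s.re → F s = LSeries (fun n => ((c n : ℝ) : ℂ)) s - 1 / (s - 1)) ∧
        ∀ s : ℂ, 1 / 2 < s.re →
          (F s).re ≤ κ + (1 / s).re + (Complex.digamma (s / 2)).re / 2 - Real.log Real.pi / 2) →
      ∀ t : ℝ, (∑ n ∈ Finset.Ico 1 N, ((c n - ArithmeticFunction.vonMangoldt n : ℝ) : ℂ) /
        (n : ℂ) ^ ((1 / 2 : ℂ) + t * I)).re ≤ κ := by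
  intro κ c N hN hsum hF t
  obtain ⟨F, hFd, hFeq, hcara⟩ := hF
  set P : ℂ → ℂ := fun z => ∑ n ∈ Finset.Ico 1 N, ((c n - Λ n : ℝ) : ℂ) / (n : ℂ) ^ z with hP
  have hPc : Continuous P := (differentiable_dirichletPoly _ N).continuous
  -- the inequality at the non-zeros of `ξ` on the line
  have hkey : ∀ u : ℝ, riemannXi (1 / 2 + u * I) ≠ 0 → (P (1 / 2 + u * I)).re ≤ κ := by
    intro u hu
    set s₀ : ℂ := 1 / 2 + u * I with hs₀
    have hre₀ : s₀.re = 1 / 2 := by simp [hs₀]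
    have hζ₀ : riemannZeta₁ s₀ ≠ 0 := (riemannXi_ne_zero_iff_of_re_pos (by rw [hre₀]; norm_num)).mp hu
    set g : ℝ → ℝ := fun ε => κ + (logDeriv riemannXi (s₀ + ε)).re - (P (s₀ + ε)).re with hg
    -- `g ≥ 0` just to the right of `s₀`
    have hev : ∀ᶠ ε in 𝓝[>] (0 : ℝ), 0 ≤ g ε := by
      have hcont : ContinuousAt (fun ε : ℝ => riemannZeta₁ (s₀ + ε)) 0 :=
        (differentiable_riemannZeta₁.continuous.comp (continuous_const.add Complex.continuous_ofReal)).continuousAt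
      have hne : ∀ᶠ ε : ℝ in 𝓝 0, riemannZeta₁ (s₀ + (ε : ℂ)) ≠ 0 :=
        hcont.eventually_ne (by simpa using hζ₀)
      filter_upwards [nhdsWithin_le_nhds hne, self_mem_nhdsWithin] with ε hε hpos
      have hpos' : (0 : ℝ) < ε := hpos
      have hsε : 1 / 2 < (s₀ + ε).re := by simp [hs₀]; linarith
      have := dirichletPoly_re_le_const_add_re_logDeriv_riemannXi κ hN hsum hFd hFeq hcara hsε hε
      simp only [hg]
      linarith
    -- `g` is continuous at `0` (`ξ(s₀) ≠ 0`)
    have hgc : ContinuousAt g 0 := by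
      have hpath : Continuous fun ε : ℝ => s₀ + (ε : ℂ) := continuous_const.add Complex.continuous_ofReal
      have hld : ContinuousAt (logDeriv riemannXi) s₀ := by
        have : logDeriv riemannXi = fun z => deriv riemannXi z / riemannXi z := by
          ext z; rw [logDeriv_apply]
        rw [this]
        exact continuous_deriv_riemannXi.continuousAt.div
          differentiable_riemannXi.continuous.continuousAt hu
      have h1 : ContinuousAt (fun ε : ℝ => logDeriv riemannXi (s₀ + ε)) 0 := by
        have h0 : s₀ + ((0 : ℝ) : ℂ) = s₀ := by simp
        exact ContinuousAt.comp (by rw [h0]; exact hld) hpath.continuousAt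
      have h2 : ContinuousAt (fun ε : ℝ => P (s₀ + ε)) 0 := (hPc.comp hpath).continuousAt
      simp only [hg]
      exact ((continuousAt_const.add (Complex.continuous_re.continuousAt.comp h1)).sub
        (Complex.continuous_re.continuousAt.comp h2))
    have h0 : 0 ≤ g 0 := ge_of_tendsto (hgc.tendsto.mono_left nhdsWithin_le_nhds) hev
    have h0' : 0 ≤ κ + (logDeriv riemannXi (s₀ + ((0 : ℝ) : ℂ))).re - (P (s₀ + ((0 : ℝ) : ℂ))).re := h0
    simp only [Complex.ofReal_zero, add_zero] at h0'
    have hxi0 : (logDeriv riemannXi s₀).re = 0 := re_logDeriv_riemannXi_half_add u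
    linarith
  by_cases hξ : riemannXi (1 / 2 + t * I) = 0
  · -- `t` is the ordinate of a zero: approach along the line through non-zeros
    set s₀ : ℂ := 1 / 2 + t * I with hs₀
    have han : AnalyticAt ℂ riemannXi s₀ := differentiable_riemannXi.analyticAt s₀
    rcases han.eventually_eq_zero_or_eventually_ne_zero with h0 | hne
    · exfalso
      have hall : EqOn riemannXi 0 univ :=
        (Complex.analyticOnNhd_univ_iff_differentiable.mpr differentiable_riemannXi)
          |>.eqOn_zero_of_preconnected_of_eventuallyEq_zero isPreconnected_univ (mem_univ s₀) h0
      have := hall (mem_univ (0 : ℂ))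
      rw [Pi.zero_apply, riemannXi_zero] at this
      norm_num at this
    · set γ : ℝ → ℂ := fun δ => s₀ + (δ : ℂ) * I with hγ
      have hγc : Continuous γ := continuous_const.add (Complex.continuous_ofReal.mul continuous_const)
      have hγ0 : γ 0 = s₀ := by simp [hγ]
      have hγt : Tendsto γ (𝓝[>] 0) (𝓝[≠] s₀) := by
        refine tendsto_nhdsWithin_iff.mpr ⟨?_, ?_⟩
        · rw [← hγ0]
          exact hγc.continuousAt.tendsto.mono_left nhdsWithin_le_nhds
        · filter_upwards [self_mem_nhdsWithin] with δ hδ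
          have hδ' : (0 : ℝ) < δ := hδ
          simp only [hγ, mem_compl_iff, mem_singleton_iff, add_eq_left, mul_eq_zero, Complex.ofReal_eq_zero,
            I_ne_zero, or_false]
          exact hδ'.ne'
      have hev : ∀ᶠ δ in 𝓝[>] (0 : ℝ), (P (γ δ)).re ≤ κ := by
        filter_upwards [hγt.eventually hne] with δ hδ
        have hform : γ δ = 1 / 2 + ((t + δ : ℝ) : ℂ) * I := by
          simp only [hγ, hs₀]; push_cast; ring
        rw [hform] at hδ ⊢
        exact hkey (t + δ) hδ
      have hlim : Tendsto (fun δ : ℝ => (P (γ δ)).re) (𝓝[>] 0) (𝓝 ((P s₀).re)) := by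
        rw [← hγ0]
        exact ((Complex.continuous_re.comp (hPc.comp hγc)).continuousAt.tendsto).mono_left nhdsWithin_le_nhds
      exact le_of_tendsto hlim hev
  · exact hkey t hξ


/-! ## The torus inequality for `ℓ¹`-modifications of `Λ` (truncation) -/

/-- **`stub_torusOfCara` for weights with `Σ |c(n) − Λ(n)|/√n < ∞`** (registered sub-goal `torusOfCara_of_summable`:
the stub's signature with the single extra hypothesis `Summable (|c n − Λ n|/√n)`).  Truncate: `c_M := Λ + (c−Λ)·𝟙_{n<M}`
is eventually `Λ`, its continuation `F_M := F − Σ_{n≥M}(c−Λ)(n)n^{-s}` is holomorphic on `re s > 1/2` and satisfies the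
majorant with `1/2` replaced by `κ_M = 1/2 + ε_M`, `ε_M = Σ_{n≥M}|c−Λ|(n)/√n` (the tail is bounded by `ε_M` on `re s ≥ 1/2`);
`re_dirichletPoly_critical_le_const` gives `Re P_M(1/2+it) ≤ κ_M`, the scaling `a ↦ a/(2κ_M)` feeds
`torusSum_le_half_of_re_le_half`, so the torus sum of `c_M − Λ` is `≤ κ_M`; for `M > n_S` it is the torus sum of `c − Λ`,
and `ε_M → 0`. [folklore] -/
theorem torusOfCara_of_summable :
    ∀ c : ℕ → ℝ, (∀ n, 0 ≤ c n) → c 1 = 0 →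
      (∀ σ : ℝ, 1 < σ → LSeriesSummable (fun n => ((c n : ℝ) : ℂ)) σ) →
      Summable (fun n : ℕ => |c n - ArithmeticFunction.vonMangoldt n| / Real.sqrt n) →
      (∃ F : ℂ → ℂ, DifferentiableOn ℂ F {s : ℂ | 1 / 2 < s.re} ∧
        (∀ s : ℂ, 1 < s.re → F s = LSeries (fun n => ((c n : ℝ) : ℂ)) s - 1 / (s - 1)) ∧
        ∀ s : ℂ, 1 / 2 < s.re →
          (F s).re ≤ 1 / 2 + (1 / s).re + (Complex.digamma (s / 2)).re / 2 - Real.log Real.pi / 2) →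
      ∀ S : Finset ℕ, (∀ p ∈ S, p.Prime) → ∀ φ : ℝ,
        ∑ A ∈ S.powerset, (c (∏ p ∈ A, p) - ArithmeticFunction.vonMangoldt (∏ p ∈ A, p)) /
            Real.sqrt (∏ p ∈ A, (p : ℝ)) * (1 / 2) ^ A.card * Real.cos ((A.card : ℝ) * φ) ≤ 1 / 2 := by
  intro c _ _ hsum hl1 hF S hS φ
  obtain ⟨F, hFd, hFeq, hcara⟩ := hF
  classical
  -- the modification, its weights, and the tails
  set m : ℕ → ℝ := fun n => c n - Λ n with hm
  set w : ℕ → ℝ := fun n => |m n| / Real.sqrt n with hw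
  have hw0 : ∀ n, 0 ≤ w n := fun n => by positivity
  have hws : Summable w := hl1
  set ε : ℕ → ℝ := fun M => ∑' k, w (k + M) with hε
  have hε0 : ∀ M, 0 ≤ ε M := fun M => tsum_nonneg fun k => hw0 _
  have hεt : Tendsto ε atTop (𝓝 0) := tendsto_sum_nat_add w
  -- the torus sum of `c − Λ` is bounded by `1/2 + ε M` for every large `M`
  set T : ℝ := ∑ A ∈ S.powerset, (c (∏ p ∈ A, p) - Λ (∏ p ∈ A, p)) /
      Real.sqrt (∏ p ∈ A, (p : ℝ)) * (1 / 2) ^ A.card * Real.cos ((A.card : ℝ) * φ) with hT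
  suffices hmain : ∀ M : ℕ, (∏ p ∈ S, p) < M → T ≤ 1 / 2 + ε M by
    have hlim : Tendsto (fun M : ℕ => 1 / 2 + ε M) atTop (𝓝 (1 / 2 + 0)) := tendsto_const_nhds.add hεt
    rw [add_zero] at hlim
    exact ge_of_tendsto hlim (Filter.eventually_atTop.mpr ⟨(∏ p ∈ S, p) + 1, fun M hM => hmain M (by omega)⟩)
  intro M hM
  have hM1 : 1 ≤ M := by
    have : 0 < ∏ p ∈ S, p := Finset.prod_pos fun p hp => (hS p hp).pos
    omega
  -- the truncated weight and the tail
  set cM : ℕ → ℝ := fun n => if n < M then c n else Λ n with hcM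
  set mt : ℕ → ℝ := fun n => if n < M then 0 else m n with hmt
  have hcMΛ : ∀ n, M ≤ n → cM n = Λ n := fun n hn => by simp [hcM, not_lt.mpr hn]
  have hcmt : ∀ n, ((cM n : ℝ) : ℂ) = ((c n : ℝ) : ℂ) - ((mt n : ℝ) : ℂ) := by
    intro n
    by_cases hn : n < M
    · simp [hcM, hmt, hn]
    · simp [hcM, hmt, hn, hm]
  -- summability of the tail everywhere on `re s ≥ 1/2`, with the bound `ε M`
  have hterm : ∀ s : ℂ, 1 / 2 ≤ s.re → ∀ n, ‖LSeries.term (fun n => ((mt n : ℝ) : ℂ)) s n‖ ≤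
      (fun n => if n < M then 0 else w n) n := by
    intro s hs n
    rcases Nat.eq_zero_or_pos n with rfl | hn
    · simp [LSeries.term]
      split_ifs <;> simp [hw0 0]
    · rw [LSeries.term_of_ne_zero hn.ne', norm_div, Complex.norm_real, Complex.norm_natCast_cpow_of_pos hn]
      simp only [hmt, hw]
      split_ifs with hlt
      · simp
      · rw [Real.norm_eq_abs]
        have hn1 : (1 : ℝ) ≤ n := by exact_mod_cast hn
        have hsq : Real.sqrt n = (n : ℝ) ^ (1 / 2 : ℝ) := Real.sqrt_eq_rpow n
        rw [hsq]
        exact div_le_div_of_nonneg_left (abs_nonneg _) (Real.rpow_pos_of_pos (by linarith) _)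
          (Real.rpow_le_rpow_of_exponent_le hn1 hs)
  have hvs : Summable (fun n => if n < M then 0 else w n) := by
    refine hws.of_nonneg_of_le (fun n => by split_ifs <;> simp [hw0 n]) (fun n => ?_)
    split_ifs <;> simp [hw0 n]
  have hv_eq : ∑' n, (if n < M then 0 else w n) = ε M := by
    rw [hε, ← hvs.sum_add_tsum_nat_add M]
    simp only
    rw [Finset.sum_eq_zero (fun n hn => by rw [if_pos (Finset.mem_range.mp hn)]), zero_add]
    refine tsum_congr fun k => ?_
    rw [if_neg (by omega)]
  have hmt_summ : ∀ s : ℂ, 1 / 2 ≤ s.re → LSeriesSummable (fun n => ((mt n : ℝ) : ℂ)) s := fun s hs =>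
    Summable.of_norm_bounded hvs (hterm s hs)
  have hmt_bound : ∀ s : ℂ, 1 / 2 ≤ s.re → ‖LSeries (fun n => ((mt n : ℝ) : ℂ)) s‖ ≤ ε M := by
    intro s hs
    refine (norm_tsum_le_tsum_norm (hmt_summ s hs).norm).trans ?_
    rw [← hv_eq]
    exact Summable.tsum_le_tsum (hterm s hs) (hmt_summ s hs).norm hvs
  -- the truncated continuation and its majorant with constant `1/2 + ε M`
  set FM : ℂ → ℂ := fun s => F s - LSeries (fun n => ((mt n : ℝ) : ℂ)) s with hFM
  have hFMd : DifferentiableOn ℂ FM {s : ℂ | 1 / 2 < s.re} := by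
    refine hFd.sub ((LSeries_differentiableOn _).mono fun s hs => ?_)
    have habs : LSeries.abscissaOfAbsConv (fun n => ((mt n : ℝ) : ℂ)) ≤ (1 / 2 : ℝ) := by
      have := (hmt_summ (1 / 2 : ℝ) (by simp)).abscissaOfAbsConv_le
      simpa using this
    have hs' : (1 / 2 : ℝ) < s.re := hs
    exact habs.trans_lt (by exact_mod_cast hs')
  have hsumM : ∀ σ : ℝ, 1 < σ → LSeriesSummable (fun n => ((cM n : ℝ) : ℂ)) σ := by
    intro σ hσ
    have h1 := (hsum σ hσ).sub (hmt_summ σ (by simp; linarith))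
    refine (LSeriesSummable_congr σ fun {n} _ => ?_).mpr h1
    rw [Pi.sub_apply, hcmt]
  have hFMeq : ∀ s : ℂ, 1 < s.re → FM s = LSeries (fun n => ((cM n : ℝ) : ℂ)) s - 1 / (s - 1) := by
    intro s hs
    have hcs : LSeriesSummable (fun n => ((c n : ℝ) : ℂ)) s :=
      (LSeriesSummable_iff_of_re_eq_re (show (s.re : ℂ).re = s.re by simp)).mp (hsum s.re hs)
    have hL : LSeries (fun n => ((cM n : ℝ) : ℂ)) s =
        LSeries (fun n => ((c n : ℝ) : ℂ)) s - LSeries (fun n => ((mt n : ℝ) : ℂ)) s := by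
      rw [← LSeries_sub hcs (hmt_summ s (by linarith))]
      exact LSeries_congr (fun {n} _ => hcmt n) s
    simp only [hFM]
    rw [hL, hFeq s hs]
    ring
  have hcaraM : ∀ s : ℂ, 1 / 2 < s.re → (FM s).re ≤
      (1 / 2 + ε M) + (1 / s).re + (Complex.digamma (s / 2)).re / 2 - Real.log Real.pi / 2 := by
    intro s hs
    have h1 := hcara s hs
    have h2 : -(LSeries (fun n => ((mt n : ℝ) : ℂ)) s).re ≤ ε M :=
      (neg_le_abs _).trans ((Complex.abs_re_le_norm _).trans (hmt_bound s hs.le))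
    simp only [hFM, sub_re]
    linarith
  -- `Re P_M(1/2 + it) ≤ 1/2 + ε M` on the critical line
  have hline := re_dirichletPoly_critical_le_const (1 / 2 + ε M) cM M hcMΛ hsumM ⟨FM, hFMd, hFMeq, hcaraM⟩
  -- scaling into the `1/2`-normalised torus theorem
  set κ : ℝ := 1 / 2 + ε M with hκ
  have hκ0 : 0 < κ := by linarith [hε0 M]
  set a : ℕ → ℝ := fun n => (cM n - Λ n) / (2 * κ) with ha
  have haN : ∀ n, M ≤ n → a n = 0 := fun n hn => by simp [ha, hcMΛ n hn]
  have hacos : ∀ t : ℝ, ∑ n ∈ Finset.Ico 1 M, a n / Real.sqrt n * Real.cos (Real.log n * t) ≤ 1 / 2 := by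
    intro t
    have ht := hline t
    rw [Complex.re_sum] at ht
    have hsum' : ∑ n ∈ Finset.Ico 1 M, (cM n - Λ n) / Real.sqrt n * Real.cos (Real.log n * t) ≤ κ := by
      calc ∑ n ∈ Finset.Ico 1 M, (cM n - Λ n) / Real.sqrt n * Real.cos (Real.log n * t)
          = ∑ n ∈ Finset.Ico 1 M, ((((cM n - Λ n : ℝ)) : ℂ) / (n : ℂ) ^ ((1 / 2 : ℂ) + t * I)).re := by
            refine Finset.sum_congr rfl fun n hn => ?_
            rw [re_ofReal_div_natCast_cpow_half_add _ _ (Finset.mem_Ico.mp hn).1]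
        _ ≤ κ := ht
    have hscale : ∑ n ∈ Finset.Ico 1 M, a n / Real.sqrt n * Real.cos (Real.log n * t) =
        (1 / (2 * κ)) * ∑ n ∈ Finset.Ico 1 M, (cM n - Λ n) / Real.sqrt n * Real.cos (Real.log n * t) := by
      rw [Finset.mul_sum]
      refine Finset.sum_congr rfl fun n _ => ?_
      simp only [ha]
      ring
    rw [hscale]
    calc 1 / (2 * κ) * ∑ n ∈ Finset.Ico 1 M, (cM n - Λ n) / Real.sqrt n * Real.cos (Real.log n * t)
        ≤ 1 / (2 * κ) * κ := by gcongr
      _ = 1 / 2 := by field_simp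
  have hTa := torusSum_le_half_of_re_le_half a M hM1 haN hacos S hS φ
  -- the torus sum of `a` is `T / (2κ)` (every `n_D`, `D ⊆ S`, is `< M`)
  have hTa_eq : ∑ D ∈ S.powerset, a (∏ p ∈ D, p) / Real.sqrt (∏ p ∈ D, (p : ℝ)) * (1 / 2) ^ D.card *
      Real.cos ((D.card : ℝ) * φ) = (1 / (2 * κ)) * T := by
    rw [hT, Finset.mul_sum]
    refine Finset.sum_congr rfl fun D hD => ?_
    have hD' : D ⊆ S := Finset.mem_powerset.mp hD
    have hlt : (∏ p ∈ D, p) < M :=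
      lt_of_le_of_lt (Finset.prod_le_prod_of_subset_of_one_le' hD' fun p hp _ => (hS p hp).one_lt.le) hM
    simp only [ha, hcM, hlt, if_true]
    ring
  rw [hTa_eq] at hTa
  -- `T/(2κ) ≤ 1/2` ⟹ `T ≤ κ`
  have : T ≤ κ := by
    have h := mul_le_mul_of_nonneg_left hTa (by positivity : (0 : ℝ) ≤ 2 * κ)
    have h' : 2 * κ * (1 / (2 * κ) * T) = T := by field_simp
    linarith
  simpa [hκ] using this

end Summit.RiemannHypothesis.RiemannHypothesis.Theorems.SignConeConeMagnification

end
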